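import Literature.NumberTheory.PAdicHodge.DeRhamFilteredComparison
import Literature.NumberTheory.PAdicHodge.TateTwistedCocycle
import HarnessLib

/-!
# Inputs of the `t`-adic dévissage for `B_dR(F)`: completeness of `Fil^m B_dR` and Tate's theorems on the
# graded pieces `Fil^N/Fil^{N+1} ≅ ℂ_F(N)`

Topic `Literature/NumberTheory/PAdicHodge`; THEOREMS ONLY (no definition, no named fact, no instance, no
`sorry`). Companion of `TateGradedDevissage` (the abstract dévissage `exists_eq_coboundary_add_of_devissage`:
hypotheses `hcomplete`, `hgrne`, `hgrz`, `hstep`) and of `TateTwistedCocycle` (Tate 1967 §3.3 Theorems 1–2, `H¹`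
halves, over `Γ_F`, modulo the named fact (TS1) `tate1967_TS1_completedAlgClosure`). For Fontaine's `B_dR(F)`
(`FracBdR F p`, filtration `fil hp hF i = ξ^i B_dR⁺`, uniformizer `u = [ε] − 1 = ξ·unit`) this file supplies
THREE of the four dévissage hypotheses:

* §1 `exists_lim_of_mem_fil_add` (**`hcomplete`**): a series `Σ y_n` with `y_n ∈ Fil^{m+n} B_dR` has a sum
  `b ∈ Fil^m` with `b − Σ_{n<M} y_n ∈ Fil^{m+M}` — the `ξ`-adic completeness of `B_dR⁺` (tree
  `isAdicComplete_bDeRhamPlus`);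
* §2 `exists_sub_coboundary_mem_fil_succ` (**`hgrne`**, modulo (TS1)): a `1`-cocycle `C : Γ_F → Fil^N B_dR`,
  `N ≠ 0`, written `C = u^N · z` with `θ ∘ z` continuous, is a coboundary modulo `Fil^{N+1}` — Tate's
  `H¹_cont(Γ_F, ℂ_F(χ^N)) = 0` (tree `TateTwisted.absGalois_exists_eq_twistedCoboundary`) read through
  `θ_N : Fil^N/Fil^{N+1} ≅ ℂ_F(N)`;
* §3 `exists_sub_coboundary_sub_log_mem_fil_one` (**`hgrz`**, modulo (TS1)): a `1`-cocycle `C : Γ_F → Fil⁰` with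
  `θ ∘ C` continuous is `∂y + log χ_cyclo · A` modulo `Fil¹`, `A ∈ F` — Tate's `H¹_cont(Γ_F, ℂ_F) = F·log χ_F`
  (tree `TateH1OverF.absGalois_exists_eq_coboundary_add_mul_logCyclotomic`) through `θ`.

What remains for `kato1993_H1_bdRFil` (file `TateH1BdRFil`) after this: the fourth hypothesis `hstep` — a
continuity predicate on cochains into `Fil^N B_dR` stable under the corrections `c ↦ c − ∂y − log χ · a` and
implying the continuity of `θ_N ∘ c` (the natural topology on `B_dR⁺/Fil^n`, Kato II §1.2.5) — and (TS1).
BSD is not proved by any of this.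

## References
* K. Kato, LNM 1553 (1993), Ch. II §1.2.5–1.2.7 (`ℂ_p(i) ≅ B^i_dR/B^{i+1}_dR`; the dévissage). [Kato1993LNM1553]
* J. Tate, *p-divisible groups* (1967), §3.3 Theorems 1–2. [Tate1967]
* J.-M. Fontaine, Astérisque 223 (1994), Exp. II §1.5.5 (`Fil^i B_dR`, `θ`, completeness). [FontaineAsterisque223III]
-/

noncomputable section

open scoped TensorProduct
open ValuativeRel Field Ideal WittVector UniformSpace
open Literature.AlgebraicGeometry.Resolution

namespace Literature.NumberTheory.PAdicHodge

open Literature.NumberTheory.GaloisRepresentations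
open Literature.NumberTheory.GaloisRepresentations.IsNonarchimedeanLocalField

variable {F : Type} [Field F] [ValuativeRel F] [TopologicalSpace F] [IsNonarchimedeanLocalField F]
  [CharZero F] {p : ℕ} [Fact p.Prime] [Fact (¬ IsUnit (p : integerC F))]
  [IsAdicComplete (Ideal.span {(p : integerC F)}) (integerC F)]
  (hp : valuation F p < 1) (hF : Function.Surjective (fontaineTheta (integerC F) p))
  [IsDomain (BDeRhamPlus (integerC F) p)]

namespace BdRTateGraded

/-! ## §0 The filtration through the uniformizer `u` (integer powers) -/

/-- `u^N · B_dR⁺ = ξ^N · B_dR⁺ = Fil^N B_dR` for every `N ∈ ℤ` (`u = ξ · v`, `v` a unit).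
[cite: FontaineAsterisque223III, Exp. II §1.5.5 (Fil^i B_dR = t^i B_dR⁺ for any uniformizer t)] -/
theorem mem_fil_iff_unif_zpow (N : ℤ) (x : FracBdR F p) :
    (letI := fracAlgebra (p := p) hp hF; x ∈ fil hp hF N) ↔
      ∃ b : BDeRhamPlus (integerC F) p,
        x = algebraMap (BDeRhamPlus (integerC F) p) (FracBdR F p) uBdR ^ N *
          algebraMap (BDeRhamPlus (integerC F) p) (FracBdR F p) b := by
  obtain ⟨v, hv, huv⟩ := exists_uBdR_eq_xiBdR_mul (F := F) (p := p) hF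
  have hU : algebraMap (BDeRhamPlus (integerC F) p) (FracBdR F p) uBdR =
      algebraMap (BDeRhamPlus (integerC F) p) (FracBdR F p) xiBdR * algebraMap _ _ ((hv.unit : (BDeRhamPlus (integerC F) p)ˣ) : BDeRhamPlus (integerC F) p) := by
    rw [IsUnit.unit_spec, huv, map_mul]
  rw [mem_fil_iff hp hF, hU, mul_zpow, ← algebraMap_units_zpow]
  constructor
  · rintro ⟨b, rfl⟩
    refine ⟨((hv.unit ^ N)⁻¹ : (BDeRhamPlus (integerC F) p)ˣ) * b, ?_⟩
    have hvv : algebraMap (BDeRhamPlus (integerC F) p) (FracBdR F p)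
          ((hv.unit ^ N : (BDeRhamPlus (integerC F) p)ˣ) : BDeRhamPlus (integerC F) p) *
        algebraMap (BDeRhamPlus (integerC F) p) (FracBdR F p)
          (((hv.unit ^ N)⁻¹ : (BDeRhamPlus (integerC F) p)ˣ) : BDeRhamPlus (integerC F) p) = 1 := by
      rw [← map_mul, Units.mul_inv, map_one]
    rw [map_mul]
    calc algebraMap (BDeRhamPlus (integerC F) p) (FracBdR F p) xiBdR ^ N *
          algebraMap (BDeRhamPlus (integerC F) p) (FracBdR F p) b
        = algebraMap (BDeRhamPlus (integerC F) p) (FracBdR F p) xiBdR ^ N *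
          (algebraMap (BDeRhamPlus (integerC F) p) (FracBdR F p)
              ((hv.unit ^ N : (BDeRhamPlus (integerC F) p)ˣ) : BDeRhamPlus (integerC F) p) *
            algebraMap (BDeRhamPlus (integerC F) p) (FracBdR F p)
              (((hv.unit ^ N)⁻¹ : (BDeRhamPlus (integerC F) p)ˣ) : BDeRhamPlus (integerC F) p)) *
          algebraMap (BDeRhamPlus (integerC F) p) (FracBdR F p) b := by rw [hvv, mul_one]
      _ = _ := by ring
  · rintro ⟨b, rfl⟩
    exact ⟨(hv.unit ^ N : (BDeRhamPlus (integerC F) p)ˣ) * b, by rw [map_mul, mul_assoc]⟩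

/-- `u^N · b ∈ Fil^N B_dR` for `b ∈ B_dR⁺`. [cite: FontaineAsterisque223III, Exp. II §1.5.5] -/
theorem unif_zpow_mul_mem_fil (N : ℤ) (b : BDeRhamPlus (integerC F) p) :
    letI := fracAlgebra (p := p) hp hF;
      algebraMap (BDeRhamPlus (integerC F) p) (FracBdR F p) uBdR ^ N *
        algebraMap (BDeRhamPlus (integerC F) p) (FracBdR F p) b ∈ fil hp hF N :=
  (mem_fil_iff_unif_zpow hp hF N _).2 ⟨b, rfl⟩

/-- `u^N · Fil^i ⊆ Fil^{N+i}`. [cite: FontaineAsterisque223III, Exp. II §1.5.5] -/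
theorem unif_zpow_mul_mem_fil_add (N : ℤ) {i : ℤ} {x : FracBdR F p}
    (hx : letI := fracAlgebra (p := p) hp hF; x ∈ fil hp hF i) :
    letI := fracAlgebra (p := p) hp hF;
      algebraMap (BDeRhamPlus (integerC F) p) (FracBdR F p) uBdR ^ N * x ∈ fil hp hF (N + i) := by
  obtain ⟨b, rfl⟩ := (mem_fil_iff_unif_zpow hp hF i x).1 hx
  have hU0 : algebraMap (BDeRhamPlus (integerC F) p) (FracBdR F p) uBdR ≠ 0 := by
    obtain ⟨v, hv, huv⟩ := exists_uBdR_eq_xiBdR_mul (F := F) (p := p) hF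
    rw [huv, map_mul]
    exact mul_ne_zero (algebraMap_xiBdR_ne_zero hF) ((map_ne_zero_iff _ algebraMap_fracBdR_injective).2 hv.ne_zero)
  rw [← mul_assoc, ← zpow_add₀ hU0]
  exact unif_zpow_mul_mem_fil hp hF _ b

omit [IsDomain (BDeRhamPlus (integerC F) p)] in
/-- **`σ(u) = k_σ u` with `k_σ` a unit of `B_dR⁺` and `θ(k_σ) = χ(σ)`** (packaged with the unit).
[cite: FontaineAsterisque223III, Exp. II §1.5.4–1.5.5 (g(t) = χ(g) t)] -/
theorem exists_unit_smul_unif (hF : Function.Surjective (fontaineTheta (integerC F) p)) (σ : absoluteGaloisGroup F) :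
    ∃ k : (BDeRhamPlus (integerC F) p)ˣ,
      galBdRPlus σ uBdR = (k : BDeRhamPlus (integerC F) p) * uBdR ∧
      thetaBdR (k : BDeRhamPlus (integerC F) p) = algebraMap F (CompletedAlgClosure F)
        (LocalField.padicRingHom F p hp (((GaloisRep.cyclotomicCharacter F p σ : ℤ_[p]ˣ) : ℤ_[p]) : ℚ_[p])) := by
  obtain ⟨k, hk, hθ⟩ := exists_galBdRPlus_uBdR_eq_mul_cyclotomic hp hF σ
  have hku : IsUnit k := by
    rw [isUnit_iff_thetaBdR_ne_zero hF, hθ]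
    exact (map_ne_zero_iff _ (algebraMap F (CompletedAlgClosure F)).injective).2 (cyclotomic_ne_zero hp σ)
  exact ⟨hku.unit, by rw [IsUnit.unit_spec]; exact hk, by rw [IsUnit.unit_spec]; exact hθ⟩

/-! ## §1 Completeness of `Fil^m B_dR` (`hcomplete`) -/

/-- **`Fil^m B_dR` is complete** (`B_dR⁺` is `ξ`-adically complete): if `y_n ∈ Fil^{m+n} B_dR` for all `n`, there is
`b ∈ Fil^m B_dR` with `b − Σ_{n<M} y_n ∈ Fil^{m+M} B_dR` for every `M` — the hypothesis `hcomplete` of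
`TateGraded.exists_eq_coboundary_add_of_devissage` for `B_dR(F)`.
[cite: FontaineAsterisque223III, Exp. II §1.5.5 (B_dR⁺ complete for the ker θ-adic topology)] [cite: Kato1993LNM1553, Ch. II §1.2.7 (lim_n)] -/
theorem exists_lim_of_mem_fil_add (m : ℤ) (y : ℕ → FracBdR F p)
    (hy : ∀ n : ℕ, letI := fracAlgebra (p := p) hp hF; y n ∈ fil hp hF (m + n)) :
    ∃ b, (letI := fracAlgebra (p := p) hp hF; b ∈ fil hp hF m) ∧
      ∀ M : ℕ, letI := fracAlgebra (p := p) hp hF; b - ∑ n ∈ Finset.range M, y n ∈ fil hp hF (m + M) := by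
  classical
  have hΞ : algebraMap (BDeRhamPlus (integerC F) p) (FracBdR F p) xiBdR ≠ 0 := algebraMap_xiBdR_ne_zero hF
  -- `y n = ξ^m · ξ^n c_n`
  have hc : ∀ n : ℕ, ∃ c : BDeRhamPlus (integerC F) p,
      y n = algebraMap (BDeRhamPlus (integerC F) p) (FracBdR F p) xiBdR ^ m * algebraMap _ (FracBdR F p) (xiBdR ^ n * c) := by
    intro n
    obtain ⟨c, hc⟩ := (mem_fil_iff hp hF).1 (hy n)
    exact ⟨c, by rw [hc, zpow_add₀ hΞ, zpow_natCast, map_mul, map_pow, mul_assoc]⟩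
  choose c hc using hc
  -- the partial sums are `ξ`-adically Cauchy in `B_dR⁺`
  set I : Ideal (BDeRhamPlus (integerC F) p) := (RingHom.ker (fontaineThetaInvertP (integerC F) p)).map
    (algebraMap (Localization.Away (p : Ainf (p := p) F)) (BDeRhamPlus (integerC F) p)) with hIdef
  have hI : I = Ideal.span {(xiBdR : BDeRhamPlus (integerC F) p)} := map_ker_eq_span_xiBdR
  set S : ℕ → BDeRhamPlus (integerC F) p := fun M => ∑ n ∈ Finset.range M, xiBdR ^ n * c n with hS
  have hmemI : ∀ (k : ℕ) (z : BDeRhamPlus (integerC F) p), xiBdR ^ k * z ∈ (I ^ k • ⊤ : Submodule (BDeRhamPlus (integerC F) p) (BDeRhamPlus (integerC F) p)) := by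
    intro k z
    rw [smul_eq_mul, Ideal.mul_top, hI, Ideal.span_singleton_pow]
    exact Ideal.mul_mem_right _ _ (Ideal.mem_span_singleton_self _)
  have hcauchy : ∀ {M M' : ℕ}, M ≤ M' → S M ≡ S M' [SMOD (I ^ M • ⊤ : Submodule (BDeRhamPlus (integerC F) p) (BDeRhamPlus (integerC F) p))] := by
    intro M M' hMM'
    rw [SModEq.sub_mem]
    obtain ⟨k, rfl⟩ := Nat.exists_eq_add_of_le hMM'
    simp only [hS, Finset.sum_range_add, sub_add_cancel_left]
    refine Submodule.neg_mem _ (Submodule.sum_mem _ fun i _ => ?_)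
    have h := hmemI M (xiBdR ^ i * c (M + i))
    rwa [← mul_assoc, ← pow_add] at h
  haveI := isAdicComplete_bDeRhamPlus (F := F) (p := p)
  obtain ⟨L, hL⟩ := IsPrecomplete.prec (IsAdicComplete.toIsPrecomplete (I := I)) hcauchy
  refine ⟨algebraMap (BDeRhamPlus (integerC F) p) (FracBdR F p) xiBdR ^ m * algebraMap _ (FracBdR F p) L,
    (mem_fil_iff hp hF).2 ⟨L, rfl⟩, fun M => ?_⟩
  -- `L − S_M = ξ^M d`
  have hLM : S M - L ∈ (I ^ M • ⊤ : Submodule (BDeRhamPlus (integerC F) p) (BDeRhamPlus (integerC F) p)) :=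
    SModEq.sub_mem.1 (hL M)
  rw [smul_eq_mul, Ideal.mul_top, hI, Ideal.span_singleton_pow, Ideal.mem_span_singleton'] at hLM
  obtain ⟨d, hd⟩ := hLM
  have hsum : ∑ n ∈ Finset.range M, y n = algebraMap (BDeRhamPlus (integerC F) p) (FracBdR F p) xiBdR ^ m * algebraMap _ (FracBdR F p) (S M) := by
    simp only [hS, map_sum, Finset.mul_sum]
    exact Finset.sum_congr rfl fun n _ => hc n
  rw [hsum, ← mul_sub, ← map_sub]
  have hLS : L - S M = xiBdR ^ M * (-d) := by rw [mul_neg, mul_comm, hd, neg_sub]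
  rw [hLS, map_mul, map_pow, ← mul_assoc, ← zpow_natCast, ← zpow_add₀ hΞ]
  exact (mem_fil_iff hp hF).2 ⟨-d, rfl⟩

/-! ## §2 The graded step at a level `N ≠ 0` (`hgrne`): Tate's `H¹(Γ_F, ℂ_F(χ^N)) = 0` through `θ` -/

set_option maxHeartbeats 400000 in
/-- **Graded step, `N ≠ 0`** (modulo (TS1)). Let `C : Γ_F → Fil^N B_dR` be a `1`-cocycle written `C(σ) = u^N z(σ)`
(`z(σ) ∈ B_dR⁺`) with `σ ↦ θ(z(σ))` continuous. Then `θ ∘ z` is a continuous `χ^N`-twisted cocycle `Γ_F → ℂ_F`,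
hence (Tate, `N ≠ 0`) a twisted coboundary `χ^N(σ) σ B₀ − B₀`; with `θ(b₀) = B₀` and `y := u^N b₀ ∈ Fil^N`,
`C(σ) − (σ y − y) ∈ Fil^{N+1}` for all `σ`. This is the hypothesis `hgrne` of the abstract dévissage for `B_dR(F)`
and cochains with continuous `θ_N`-projection. [cite: Kato1993LNM1553, Ch. II §1.2.6–1.2.7 (ℂ_p(i) ≅ B^i_dR/B^{i+1}_dR; H^1(K, ℂ_p(i)) = 0, i ≠ 0)]
[cite: Tate1967, §3.3 Theorem 2] -/
theorem exists_sub_coboundary_mem_fil_succ (hTS1 : tate1967_TS1_completedAlgClosure) {N : ℤ} (hN : N ≠ 0)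
    (C : absoluteGaloisGroup F → FracBdR F p)
    (hC : ∀ σ τ : absoluteGaloisGroup F, C (σ * τ) = C σ + σ • C τ)
    (z : absoluteGaloisGroup F → BDeRhamPlus (integerC F) p)
    (hz : ∀ σ, C σ = algebraMap (BDeRhamPlus (integerC F) p) (FracBdR F p) uBdR ^ N *
      algebraMap (BDeRhamPlus (integerC F) p) (FracBdR F p) (z σ))
    (hcont : Continuous fun σ => thetaBdR (z σ)) :
    ∃ y, (letI := fracAlgebra (p := p) hp hF; y ∈ fil hp hF N) ∧
      ∀ σ, letI := fracAlgebra (p := p) hp hF; C σ - (σ • y - y) ∈ fil hp hF (N + 1) := by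
  set U : FracBdR F p := algebraMap (BDeRhamPlus (integerC F) p) (FracBdR F p) uBdR with hUdef
  have hU0 : U ≠ 0 := by
    obtain ⟨v, hv, huv⟩ := exists_uBdR_eq_xiBdR_mul (F := F) (p := p) hF
    rw [hUdef, huv, map_mul]
    exact mul_ne_zero (algebraMap_xiBdR_ne_zero hF) ((map_ne_zero_iff _ algebraMap_fracBdR_injective).2 hv.ne_zero)
  -- the units `k_σ` with `σ u = k_σ u`, `θ(k_σ) = χ(σ)`
  choose k hk hθk using exists_unit_smul_unif hp hF
  -- `z` is a `k^N`-twisted cocycle in `B_dR⁺`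
  have hzcoc : ∀ σ τ, z (σ * τ) = z σ + ((k σ ^ N : (BDeRhamPlus (integerC F) p)ˣ) : BDeRhamPlus (integerC F) p) *
      galBdRPlus σ (z τ) := by
    intro σ τ
    apply algebraMap_fracBdR_injective (F := F) (p := p)
    apply mul_left_cancel₀ (zpow_ne_zero N hU0)
    have h := hC σ τ
    rw [hz, hz, hz, smul_mul', smul_fracBdR_eq_toRingHom σ (U ^ N), map_zpow₀, ← smul_fracBdR_eq_toRingHom,
      hUdef, smul_algebraMap_fracBdR, smul_algebraMap_fracBdR, hk σ, map_mul, mul_zpow,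
      ← algebraMap_units_zpow] at h
    rw [h, map_add, map_mul, mul_add]
    ring
  -- `θ ∘ z` is a continuous `χ^N`-twisted cocycle
  have hθcoc : ∀ σ τ : absoluteGaloisGroup F, thetaBdR (z (σ * τ)) = thetaBdR (z σ) +
      (algebraMap F (CompletedAlgClosure F)
        (LocalField.padicRingHom F p hp
          (((GaloisRep.cyclotomicCharacter F p σ : ℤ_[p]ˣ) : ℤ_[p]) : ℚ_[p]))) ^ N * (σ • thetaBdR (z τ)) := by
    intro σ τ
    rw [hzcoc σ τ, map_add, map_mul, ringHom_units_zpow, hθk σ, thetaBdR_galBdRPlus]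
  obtain ⟨B₀, hB₀⟩ := TateTwisted.absGalois_exists_eq_twistedCoboundary hp hTS1 hN hθcoc hcont
  obtain ⟨b₀, hb₀⟩ := thetaBdR_surjective hF B₀
  refine ⟨U ^ N * algebraMap _ (FracBdR F p) b₀, unif_zpow_mul_mem_fil hp hF N b₀, fun σ => ?_⟩
  -- `C σ − ∂y σ = u^N (z σ − k_σ^N σ b₀ + b₀)` with `θ(…) = 0`
  have hdiff : C σ - (σ • (U ^ N * algebraMap _ (FracBdR F p) b₀) - U ^ N * algebraMap _ (FracBdR F p) b₀) =
      U ^ N * algebraMap _ (FracBdR F p)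
        (z σ - ((k σ ^ N : (BDeRhamPlus (integerC F) p)ˣ) : BDeRhamPlus (integerC F) p) * galBdRPlus σ b₀ + b₀) := by
    rw [hz, smul_mul', smul_fracBdR_eq_toRingHom σ (U ^ N), map_zpow₀, ← smul_fracBdR_eq_toRingHom, hUdef,
      smul_algebraMap_fracBdR, smul_algebraMap_fracBdR, hk σ, map_mul, mul_zpow, ← algebraMap_units_zpow,
      map_add, map_sub, map_mul]
    ring
  rw [hdiff]
  refine unif_zpow_mul_mem_fil_add hp hF N (algebraMap_mem_fil_one_of_mem_span hp hF
    ((mem_ker_thetaBdR_iff _).1 ?_))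
  rw [map_add, map_sub, map_mul, ringHom_units_zpow, hθk σ, thetaBdR_galBdRPlus, hb₀, hB₀ σ]
  ring

/-! ## §3 The graded step at level `0` (`hgrz`): Tate's `H¹(Γ_F, ℂ_F) = F · log χ_F` through `θ` -/

/-- **Graded step, `N = 0`** (modulo (TS1)). Let `C : Γ_F → B_dR⁺ = Fil⁰` be a `1`-cocycle, `C(σ) = z(σ)`, with
`σ ↦ θ(z(σ))` continuous. Then `θ ∘ z` is a continuous cocycle `Γ_F → ℂ_F`, hence (Tate) `σ B₀ − B₀ + A·log χ_F(σ)`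
with `A ∈ F`; with `θ(b₀) = B₀`, `y := b₀`, `C(σ) − (σ y − y) − log χ_cyclo(σ)·A ∈ Fil¹` for all `σ` (the scalars
`log χ_cyclo(σ) ∈ ℚ_p` and `A ∈ F` enter `B_dR` through `F ↪ B_dR⁺`). This is the hypothesis `hgrz` of the abstract
dévissage for `B_dR(F)` and cochains with continuous `θ`-projection.
[cite: Kato1993LNM1553, Ch. II §1.2.7 (H^1(K, ℂ_p) = K · log χ_cyclo)] [cite: Tate1967, §3.3 Theorem 1] -/
theorem exists_sub_coboundary_sub_log_mem_fil_one (hTS1 : tate1967_TS1_completedAlgClosure)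
    (C : absoluteGaloisGroup F → FracBdR F p)
    (hC : ∀ σ τ : absoluteGaloisGroup F, C (σ * τ) = C σ + σ • C τ)
    (z : absoluteGaloisGroup F → BDeRhamPlus (integerC F) p)
    (hz : ∀ σ, C σ = algebraMap (BDeRhamPlus (integerC F) p) (FracBdR F p) (z σ))
    (hcont : Continuous fun σ => thetaBdR (z σ)) :
    ∃ y, (letI := fracAlgebra (p := p) hp hF; y ∈ fil hp hF 0) ∧ ∃ A : F,
      ∀ σ, letI := fracAlgebra (p := p) hp hF;
        C σ - (σ • y - y) -
          algebraMap (BDeRhamPlus (integerC F) p) (FracBdR F p)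
            (embBdRHom hp hF (LocalField.padicRingHom F p hp (logCyclotomic p σ))) *
          algebraMap (BDeRhamPlus (integerC F) p) (FracBdR F p) (embBdRHom hp hF A) ∈ fil hp hF 1 := by
  -- `z` is a cocycle in `B_dR⁺`
  have hzcoc : ∀ σ τ, z (σ * τ) = z σ + galBdRPlus σ (z τ) := by
    intro σ τ
    apply algebraMap_fracBdR_injective (F := F) (p := p)
    have h := hC σ τ
    rw [hz, hz, hz, smul_algebraMap_fracBdR] at h
    rw [h, map_add]
  have hθcoc : ∀ σ τ : absoluteGaloisGroup F, thetaBdR (z (σ * τ)) = thetaBdR (z σ) + σ • thetaBdR (z τ) := by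
    intro σ τ
    rw [hzcoc σ τ, map_add, thetaBdR_galBdRPlus]
  obtain ⟨B₀, A, hBA⟩ := TateH1OverF.absGalois_exists_eq_coboundary_add_mul_logCyclotomic hp hTS1 hθcoc hcont
  obtain ⟨b₀, hb₀⟩ := thetaBdR_surjective hF B₀
  refine ⟨algebraMap _ (FracBdR F p) b₀, algebraMap_mem_fil_zero hp hF b₀, A, fun σ => ?_⟩
  rw [hz, smul_algebraMap_fracBdR, ← map_sub, ← map_sub, ← map_mul, ← map_sub]
  refine algebraMap_mem_fil_one_of_mem_span hp hF ((mem_ker_thetaBdR_iff _).1 ?_)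
  rw [map_sub, map_sub, map_sub, map_mul, thetaBdR_galBdRPlus, thetaBdR_embBdRHom, thetaBdR_embBdRHom, hb₀,
    hBA σ]
  ring

end BdRTateGraded

end Literature.NumberTheory.PAdicHodge

end
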